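import Literature.Probability.Percolation.KozmaNitzanReduction
import Literature.Probability.LatticeModels.ProdBernoulliIndependence
import Literature.Probability.Percolation.PercolationProofs
import HarnessLib

/-!
# Mean-intersection gluing: the proved fragment of Kozma–Nitzan's Conjecture 3

Kozma–Nitzan (arXiv:2401.12397, p. 15, Conjecture 3 = `KozmaNitzan2024_conjecture3`; their
Theorem 6, formalised in the tree as `percolationContinuityZ3_of_slabPercolation` +
`KozmaNitzan2024_slabPercolation_holds`, makes it imply `PercolationContinuityZ3`) asks for a
`δ(ε)` **uniform in the graph and in `|A|`** such that `P(o ↔ A) > 1-δ` and `P(a ↔ b) > 1-δ`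
for all `a ∈ A` force `P(o ↔ b) > 1-ε`.

This file proves, sorry-free, the elementary Harris-inequality bound
`P(o ↔ A) - P(o ↔ b) ≤ Σ_{a∈A} P(o ↔ a)·(1 - P(a ↔ b))`
(`real_biUnion_openConn_sub_le`), hence Conjecture 3 **with `δ = ε/(M+2)` on every instance whose
mean intersection `E|C(o) ∩ A| = Σ_{a∈A} P(o ↔ a)` is at most `M`**
(`gluing_of_meanIntersection_le`, `conjecture3_of_card_le`), and the contrapositive
localisation of any counterexample: a family violating Conjecture 3 at level `ε` with
hypothesis-deficit `δ` must have `E|C(o) ∩ A| ≥ (ε - δ)/δ` (`meanIntersection_large_of_violation`).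
This is where a computational counterexample search has to look (solo seat
`solo-CriticalPhenomena-informed`, census `paper/sharpest-statement.md`).
-/

noncomputable section

namespace Summit.CriticalPhenomena.PercolationContinuityZ3.Theorems

open MeasureTheory Literature.Probability.Percolation Literature.Probability.LatticeModels

variable {n : ℕ}

/-- If `o ↔ a` for some `a ∈ A` but `o ↮ b`, then that `a` satisfies `a ↮ b`. -/
theorem biUnion_openConn_diff_subset (A : Finset (Fin n)) (o b : Fin n) :
    (⋃ a ∈ A, openConn o a) \ openConn o b ⊆
      ⋃ a ∈ A, (openConn o a ∩ (openConn a b)ᶜ : Set (BondConfig (Fin n))) := by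
  rintro ω ⟨hU, hnot⟩
  simp only [Set.mem_iUnion] at hU ⊢
  obtain ⟨a, ha, hoa⟩ := hU
  refine ⟨a, ha, hoa, fun hab => hnot ?_⟩
  exact SimpleGraph.Reachable.trans hoa hab

/-- **Mean-intersection gluing bound** (Harris): for Bernoulli percolation with arbitrary edge
weights on `Fin n`,  `P(o ↔ A) - P(o ↔ b) ≤ Σ_{a∈A} P(o ↔ a) · (1 - P(a ↔ b))`. -/
theorem real_biUnion_openConn_sub_le (w : Sym2 (Fin n) → unitInterval) (A : Finset (Fin n))
    (o b : Fin n) :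
    (prodBernoulli w).real (⋃ a ∈ A, openConn o a) - (prodBernoulli w).real (openConn o b) ≤
      ∑ a ∈ A, (prodBernoulli w).real (openConn o a) *
        (1 - (prodBernoulli w).real (openConn a b)) := by
  have hsub : (⋃ a ∈ A, openConn o a) ⊆
      openConn o b ∪ ((⋃ a ∈ A, openConn o a) \ openConn o b) := by
    intro ω hω
    by_cases h : ω ∈ openConn o b
    · exact Or.inl h
    · exact Or.inr ⟨hω, h⟩
  have h1 : (prodBernoulli w).real (⋃ a ∈ A, openConn o a) ≤
      (prodBernoulli w).real (openConn o b) +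
        (prodBernoulli w).real ((⋃ a ∈ A, openConn o a) \ openConn o b) :=
    (measureReal_mono hsub (measure_ne_top _ _)).trans (measureReal_union_le _ _)
  have h2 : (prodBernoulli w).real ((⋃ a ∈ A, openConn o a) \ openConn o b) ≤
      ∑ a ∈ A, (prodBernoulli w).real (openConn o a ∩ (openConn a b)ᶜ) :=
    (measureReal_mono (biUnion_openConn_diff_subset A o b) (measure_ne_top _ _)).trans
      (measureReal_biUnion_finset_le A
        (fun a => (openConn o a ∩ (openConn a b)ᶜ : Set (BondConfig (Fin n)))))
  have h3 : ∀ a ∈ A, (prodBernoulli w).real (openConn o a ∩ (openConn a b)ᶜ) ≤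
      (prodBernoulli w).real (openConn o a) * (1 - (prodBernoulli w).real (openConn a b)) := by
    intro a _
    have hH := prodBernoulli_harris_upper_lower w (isUpperSet_openConn o a)
      (isUpperSet_openConn a b).compl (measurableSet_openConn_holds o a)
      (measurableSet_openConn_holds a b).compl
    have hc : (prodBernoulli w).real (openConn a b)ᶜ = 1 - (prodBernoulli w).real (openConn a b) := by
      rw [measureReal_compl (measurableSet_openConn_holds a b), probReal_univ]
    rw [hc] at hH
    exact hH
  have h4 := Finset.sum_le_sum h3
  linarith

/-- **Conjecture 3 on instances of bounded mean intersection.** If the hypothesis deficits are at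
most `δ` and `E|C(o) ∩ A| = Σ_{a∈A} P(o ↔ a) ≤ M`, then `P(o ↔ b) ≥ P(o ↔ A) - δ M`. -/
theorem gluing_of_meanIntersection_le (w : Sym2 (Fin n) → unitInterval) (A : Finset (Fin n))
    (o b : Fin n) {δ M : ℝ} (hδ : 0 ≤ δ)
    (hM : ∑ a ∈ A, (prodBernoulli w).real (openConn o a) ≤ M)
    (hb : ∀ a ∈ A, 1 - δ ≤ (prodBernoulli w).real (openConn a b)) :
    (prodBernoulli w).real (⋃ a ∈ A, openConn o a) - δ * M ≤
      (prodBernoulli w).real (openConn o b) := by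
  have h := real_biUnion_openConn_sub_le w A o b
  have h' : ∑ a ∈ A, (prodBernoulli w).real (openConn o a) *
      (1 - (prodBernoulli w).real (openConn a b)) ≤
      ∑ a ∈ A, (prodBernoulli w).real (openConn o a) * δ := by
    apply Finset.sum_le_sum
    intro a ha
    apply mul_le_mul_of_nonneg_left _ measureReal_nonneg
    linarith [hb a ha]
  rw [← Finset.sum_mul] at h'
  have h'' : (∑ a ∈ A, (prodBernoulli w).real (openConn o a)) * δ ≤ M * δ :=
    mul_le_mul_of_nonneg_right hM hδ
  nlinarith

/-- **Kozma–Nitzan Conjecture 3 restricted to `|A| ≤ K` holds with `δ = ε/(K+2)`** — the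
`|A|`-dependent form that Kozma–Nitzan note is easy; the whole difficulty of
`KozmaNitzan2024_conjecture3` is the uniformity in `|A|` (arXiv:2401.12397, p. 15). -/
theorem conjecture3_of_card_le (K : ℕ) (ε : ℝ) (hε : 0 < ε) :
    ∃ δ : ℝ, 0 < δ ∧ ∀ (n : ℕ) (w : Sym2 (Fin n) → unitInterval) (A : Finset (Fin n))
      (o b : Fin n), A.card ≤ K →
      1 - δ < (prodBernoulli w).real (⋃ a ∈ A, openConn o a) →
        (∀ a ∈ A, 1 - δ < (prodBernoulli w).real (openConn a b)) →
          1 - ε < (prodBernoulli w).real (openConn o b) := by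
  refine ⟨ε / (K + 2), by positivity, ?_⟩
  intro n w A o b hK hA hb
  have hKr : (A.card : ℝ) ≤ K := by exact_mod_cast hK
  have hM : ∑ a ∈ A, (prodBernoulli w).real (openConn o a) ≤ K := by
    calc ∑ a ∈ A, (prodBernoulli w).real (openConn o a) ≤ ∑ _a ∈ A, (1 : ℝ) :=
          Finset.sum_le_sum fun a _ => measureReal_le_one
      _ = A.card := by simp
      _ ≤ K := hKr
  have hg := gluing_of_meanIntersection_le w A o b (δ := ε / (K + 2)) (M := K)
    (by positivity) hM (fun a ha => (hb a ha).le)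
  have hK0 : (0 : ℝ) ≤ K := by positivity
  have hfrac : ε / (K + 2) + ε / (K + 2) * K < ε := by
    rw [← mul_one_add, div_mul_eq_mul_div, div_lt_iff₀ (by positivity)]
    nlinarith
  linarith

/-- **Where a counterexample must live.** In any instance where the hypotheses of Conjecture 3
hold with deficit `δ > 0` but the conclusion fails at level `ε`, the mean intersection
`E|C(o) ∩ A| = Σ_{a∈A} P(o ↔ a)` is at least `(ε - δ)/δ`; in particular a violating family
(fixed `ε`, `δ → 0`) has `E|C(o) ∩ A| → ∞`. -/
theorem meanIntersection_large_of_violation (w : Sym2 (Fin n) → unitInterval)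
    (A : Finset (Fin n)) (o b : Fin n) {δ ε : ℝ} (hδ : 0 < δ)
    (hA : 1 - δ ≤ (prodBernoulli w).real (⋃ a ∈ A, openConn o a))
    (hb : ∀ a ∈ A, 1 - δ ≤ (prodBernoulli w).real (openConn a b))
    (hfail : (prodBernoulli w).real (openConn o b) ≤ 1 - ε) :
    (ε - δ) / δ ≤ ∑ a ∈ A, (prodBernoulli w).real (openConn o a) := by
  set S := ∑ a ∈ A, (prodBernoulli w).real (openConn o a)
  have hg := gluing_of_meanIntersection_le w A o b (δ := δ) (M := S) hδ.le le_rfl hb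
  rw [div_le_iff₀ hδ]
  nlinarith

end Summit.CriticalPhenomena.PercolationContinuityZ3.Theorems
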